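import Literature.MathematicalPhysics.QuantumFieldTheory.Balaban1983to89.B6HprimeOpNormV1
import Literature.MathematicalPhysics.QuantumFieldTheory.Balaban1983to89.B6Eq2130TwoScaleV1Landau
import Literature.MathematicalPhysics.QuantumFieldTheory.Balaban1983to89.B6GOneLevelV1Bridge
import Literature.MathematicalPhysics.QuantumFieldTheory.Balaban1983to89.B6Ineq2147TwoScaleV1Upper
import Literature.MathematicalPhysics.QuantumFieldTheory.Balaban1983to89.B5Prop11Lattice

/-!
# `Balaban1983to89.B6HjGtOpNormV1` — T. Bałaban, *Propagators and renormalization transformations for lattice gauge theories. II*,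
# Commun. Math. Phys. **96** (1984) 223–250 [Balaban1984PropagatorsII], p. 246, text after (2.131): «ALL THE NECESSARY PROPERTIES OF THE
# OPERATORS H_j, G̃_j. THEY FOLLOW FROM THE PROPOSITION 1.2 …» — THE ℓ²-BOUNDS, AS OPERATOR-NORM STATEMENTS FOR THE CONCRETE TWO-SCALE V1 DATA:
# `‖H_jB‖ ≤ (d+1)·A·K·n^{(d+1)/2}‖B‖`, `γ₀‖A‖² ≤ ⟨A, M_jA⟩` on `{Q_jA = 0}`, `⟨x, G̃_jx⟩ ≤ γ₀⁻¹‖x‖²`, `‖G̃_jx‖ ≤ γ₀⁻¹‖x‖`, uniformly in the volume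

statement-level skeleton of published theorems with citation tags; proofs where landed; nothing here is a claim about the Yang–Mills mass gap

PDF held: `paper:balaban1984-cmp96-propagators-rt-ii` (journal page = PDF page + 222), p. 246 [PDF 24], p. 248 [PDF 26]; text layer read this
session (`p0024.txt`).  PRINT (verbatim, p. 246, after (2.129); v1.1 replaces v1.0's paraphrase, which was NOT the printed wording): *"We have to
investigate yet the operators G̃_j, H_j, and H′_j. Doing similar calculations as in Sect. E, (1.91)–(1.103), in fact much simpler, we get the formula
H_j = G_jQ_j*(Q_jG_jQ_j*)⁻¹ (2.130) Thus this operator coincides with the operator introduced in Sect. D. For G̃_j we get G̃_j = G_j −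
G_jQ_j*(Q_jG_jQ_j*)⁻¹Q_jG_j. (2.131) From these representations we obtain all the necessary properties of the operators H_j, G̃_j. They follow from
the Proposition 1.2 and from the formulas and the inequalities (1.99)–(1.101) for Q_jG_jQ_j*. … All the above considerations imply the following
Proposition 2.5."* (`Proposition 1.2` = [Balaban1984PropagatorsI] = [4], Prop. 1.2 p. 35; also used here: [4] (1.72) p. 30, the zero-mode step for
`Δ_a = (Δ − ∂P∂*) + aQ*Q`, and [4] Prop. 1.1 (1.90) p. 33 «Δ_a = G⁻¹ ≥ γ₀(Δ + I)»).  Among «the necessary properties» THIS FILE takes the ℓ²-bounds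
only (no decay).  In (2.129) `G̃_j` and `H_j` enter through `⟨(I − K₂)J, (G̃_j + H_jC̃^{(j)}_ΛH_j*)(I − K₂)J⟩`.

CITATION HEADER (lean-in-tree rule) — WHAT IS REPRODUCED.  Phase-2 file of the `lit-balaban` typed skeleton (HOME `run/shared/lean/pub/lit-balaban/`),
seat **p22 gen 13** (B6 fold owner r03, referee ref-4; lane = Sect. C (2.95)–(2.147) on the concrete two-scale data
`…B6SectCTwoScaleV1Lattice.tsV1`), file 3 of 4 toward the ℓ²-BOUNDEDNESS MEMBER OF PROP. 2.5 AT TWO LEVELS; SKELETON rows **B6.Eq2.130** /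
**B6.Eq2.131** (cells; decls of record untouched: this seat's gen 9 `…B6Eq2130TwoScaleV1Landau.Hj_single_apply'` — the matrix of the concrete `H_j`
IS b05's (1.63) torus kernel `…B5Hk163Torus.HkOp`, bounded entrywise by `…B5Hk163Torus.norm_HkOp_le`; r03 gen 10 `…B6GOneLevelV1Bridge.form_deltaAE` —
the V1 form `⟨A, Δ_aA⟩` of the whole-torus family IS r02's [4] (1.69) form, for which `…B5Prop11Lattice.ineq190_form` is (1.90)).  THIS FILE:
§1 four elementary finite-dimensional lemmas (ours): Cauchy–Schwarz for a symmetric non-negative form `inner_sq_le_of_symm_nonneg`, «form bound ⇒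
norm bound» `norm_le_of_form_le` (`S = S* ≥ 0`, `⟨x,Sx⟩ ≤ β‖x‖² ⇒ ‖Sx‖ ≤ β‖x‖`), `norm_adjoint_le` (`‖T‖ ≤ X ⇒ ‖T*‖ ≤ X`), and for p22's
covariance `…B6CovarianceOperator.covOp`: `inner_covOp_nonneg`, `norm_covOp_le_of_ge`; §2 **`norm_Hj_sq_le`** / **`norm_Hj_le`**: `‖H_jB‖² ≤
((d+1)·A·K)²·n^{d+1}·‖B‖²`, `A = MG163(d+1)·periodConst(κ₁₆₃(d+1), d)` b05's kernel constant, `K = latticeConst(d+1)(κ₁₆₃(d+1)/(d+1))`, `n = L^j`,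
by file 1 `…B6SchurTorusBound.norm_sq_le_of_entry_decay` (rows = fine bonds ↦ block of the initial point, `≤ (d+1)n^{d+1}` per block; columns = unit
bonds ↦ initial point, `≤ d+1` per site: `card_filter_src_le`); §3 at the paper's scaling `c = η⁻¹ = L^j`: **`inner_Mj_ge_of_Qv_eq_zero`**
(`γ₀(d+1,1)·‖A‖² ≤ ⟨A, M_jA⟩` for `Q_jA = 0`, `γ₀ = …B5Prop11Lattice.gammaZero`: on `{Q_jA = 0}` the form of `M_j = Δ − ∂P_j∂*` is the whole-torus
`⟨A, Δ_aA⟩` with [4]'s weight `a = 1` (V1 weight `n^{d+1}`, r03's dictionary `inner_QE_aE_whole`), which r03's bridge carries to r02's matrix form, where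
(1.90) and `Δ ≥ 0` give `≥ γ₀·Ã†Ã = γ₀‖A‖²`), **`inner_Gt_le`** (`⟨x, G̃_jx⟩ ≤ γ₀⁻¹‖x‖²`, this seat's gen 10 `…B6Ineq2147TwoScaleV1Upper.inner_covOp_le_of_ge'`),
`inner_Gt_nonneg`, **`norm_Gt_le`** (`‖G̃_jx‖ ≤ γ₀⁻¹‖x‖`) — UNIFORM in the volume `(m, K)`, in `j` and in `Λ′`.  IMPORTS BY NAME, restating nothing
(see the `open` lines).  THEOREMS ONLY (no definition, no `def … : Prop`); standard axioms.  HONEST SCOPE: finite tori of the V1 calculus; §2 is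
written for the parameter set `⟨d + 1, L, m, K, _, _⟩` with `[NeZero L]` (file 1's torus lemmas index the dimension as `d + 1`), §3 for every
`P : Params` at `c = L^j`; constants ours (`γ₀(d,a) = 1/((d+1)²·Cst(d,a))` is r02's, dimension-only at `a = 1`); the exponential decay of the kernels of
`G̃_j`, `H_j` is NOT treated here (kernel level stays in b05's/r03's files); NOT summit progress.  Unit `lit-balaban-p22` (gen 13), 2026-08-22.
-/

noncomputable section

open scoped InnerProductSpace BigOperators Matrix ComplexConjugate
open Finset

namespace Literature.MathematicalPhysics.QuantumFieldTheory.Balaban1983to89.B6HjGtOpNormV1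

open LatticeFieldCalculus B5SectBStatements B5Eq117TorusCarriers B6SectAOperatorsV1 B6SectADomainsV1 B6SectAVectorModelV1
  B6SectCOperators B6SectCOperators.TwoScaleData B6SectCTwoScaleV1 B6SectCTwoScaleV1Lattice B6CovarianceOperator
open BalabanImbrieJaffe1984to88.BIJ85AxialPropagator411 (BondSpace)
open B5Prop11Plancherel (Tor fine)
open B5Blocks16 (blockOf_bpt)
open B5G183Kernel (exists_eq_bpt)
open B5Hk163Torus (HkOp norm_HkOp_le)
open B5Hk163Decay (MG163 MG163_nonneg)
open B5Hk163Strip (kappa163 kappa163_pos)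
open B4TorusKernel (periodConst)
open B4TorusKernel.MultiPeriod (torusSupNorm)
open B4Sect5Proof (latticeConst latticeConst_nonneg)
open B6LowerBound2153Torus (toT rep toT_rep)
open B5Kernel166Decay (periodConst_pos)
open B6SchurTorusBound (norm_sq_le_of_entry_decay)
open B6HprimeOpNormV1 (card_filter_blockOf_EK_le card_filter_eq_le_one)
open B6Eq2130TwoScaleV1Landau (Hj_single_apply' Rj_eq_RE)
open B6GOneLevelV1Bridge (TV form_deltaAE star_TV_dotProduct_TV)
open B6SectAWholeTorusBridge (mem_ker_QpE_whole_iff)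
open B6SectAWholeTorusData (idxB idxB_bijective)
open B6SectCPositivity (Mj_pos_ker)
open B6Ineq2147TwoScaleV1Upper (inner_covOp_le_of_ge')
open B5Prop11Lattice (gammaZero gammaZero_pos ineq190_form)
open B5Prop11Lower (Lap form_gram nsq_nonneg)
open B5DeltaA169 (DeltaA)

/-! ## §1  Elementary finite-dimensional lemmas: symmetric non-negative forms, adjoints, covariances -/

section Generic

variable {E F : Type*} [NormedAddCommGroup E] [InnerProductSpace ℝ E] [NormedAddCommGroup F] [InnerProductSpace ℝ F]

/-- **Cauchy–Schwarz for a symmetric non-negative form**: `⟨x, Sy⟩² ≤ ⟨x, Sx⟩⟨y, Sy⟩` (discriminant of `t ↦ ⟨x + ty, S(x + ty)⟩ ≥ 0`).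
[cite: Balaban1984PropagatorsII, p.246, text after (2.131) («all the necessary properties of the operators H_j, G̃_j»; elementary step, ours)] -/
theorem inner_sq_le_of_symm_nonneg (S : E →ₗ[ℝ] E) (hS : ∀ x y, ⟪S x, y⟫_ℝ = ⟪x, S y⟫_ℝ) (h0 : ∀ x, 0 ≤ ⟪x, S x⟫_ℝ)
    (x y : E) : ⟪x, S y⟫_ℝ ^ 2 ≤ ⟪x, S x⟫_ℝ * ⟪y, S y⟫_ℝ := by
  have hyx : ⟪y, S x⟫_ℝ = ⟪x, S y⟫_ℝ := by rw [real_inner_comm (S x) y, hS]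
  have hq : ∀ t : ℝ, 0 ≤ ⟪y, S y⟫_ℝ * (t * t) + 2 * ⟪x, S y⟫_ℝ * t + ⟪x, S x⟫_ℝ := by
    intro t
    have h := h0 (x + t • y)
    rw [map_add, map_smul, inner_add_left, inner_add_right, inner_add_right, real_inner_smul_left, real_inner_smul_left,
      real_inner_smul_right, real_inner_smul_right, hyx] at h
    linarith
  have hd := discrim_le_zero hq
  rw [discrim] at hd
  nlinarith [hd]

/-- **«form bound ⇒ norm bound» for a symmetric non-negative operator**: `⟨x, Sx⟩ ≤ β‖x‖²` for all `x` ⇒ `‖Sx‖ ≤ β‖x‖`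
(`‖Sx‖⁴ = ⟨x, S(Sx)⟩² ≤ ⟨x, Sx⟩⟨Sx, S(Sx)⟩ ≤ β‖x‖²·β‖Sx‖²`). [cite: Balaban1984PropagatorsII, p.246, Prop. 2.5 («satisfies … (1.114)», the L²-norm member; elementary step, ours)] -/
theorem norm_le_of_form_le (S : E →ₗ[ℝ] E) (hS : ∀ x y, ⟪S x, y⟫_ℝ = ⟪x, S y⟫_ℝ) (h0 : ∀ x, 0 ≤ ⟪x, S x⟫_ℝ)
    {β : ℝ} (hβ : 0 ≤ β) (hle : ∀ x, ⟪x, S x⟫_ℝ ≤ β * ‖x‖ ^ 2) (x : E) : ‖S x‖ ≤ β * ‖x‖ := by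
  have h1 : ‖S x‖ ^ 2 = ⟪x, S (S x)⟫_ℝ := by rw [← hS, real_inner_self_eq_norm_sq]
  have h2 : (‖S x‖ ^ 2) ^ 2 ≤ (β * ‖x‖ ^ 2) * (β * ‖S x‖ ^ 2) :=
    calc (‖S x‖ ^ 2) ^ 2 = ⟪x, S (S x)⟫_ℝ ^ 2 := by rw [h1]
      _ ≤ ⟪x, S x⟫_ℝ * ⟪S x, S (S x)⟫_ℝ := inner_sq_le_of_symm_nonneg S hS h0 x (S x)
      _ ≤ (β * ‖x‖ ^ 2) * (β * ‖S x‖ ^ 2) := mul_le_mul (hle x) (hle (S x)) (h0 _) (by positivity)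
  by_cases hx : S x = 0
  · rw [hx, norm_zero]; positivity
  · have hpos : 0 < ‖S x‖ ^ 2 := by positivity
    have h3 : ‖S x‖ ^ 2 ≤ (β * ‖x‖) ^ 2 := by nlinarith [h2, hpos]
    exact le_of_sq_le_sq h3 (by positivity)

variable [FiniteDimensional ℝ E] [FiniteDimensional ℝ F]

/-- **`‖T‖ ≤ X ⇒ ‖T*‖ ≤ X`**: `‖T*f‖² = ⟨f, TT*f⟩ ≤ ‖f‖·X‖T*f‖`. [cite: Balaban1984PropagatorsII, (2.129) p.246 (the factors `H′_j*∂*`, `H_j*`; elementary step, ours)] -/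
theorem norm_adjoint_le (T : E →ₗ[ℝ] F) {X : ℝ} (hX : 0 ≤ X) (hT : ∀ e, ‖T e‖ ≤ X * ‖e‖) (f : F) :
    ‖LinearMap.adjoint T f‖ ≤ X * ‖f‖ := by
  set g := LinearMap.adjoint T f with hg
  have h1 : ‖g‖ ^ 2 = ⟪f, T g⟫_ℝ := by rw [← real_inner_self_eq_norm_sq, hg, LinearMap.adjoint_inner_left]
  have h2 : ‖g‖ ^ 2 ≤ ‖f‖ * (X * ‖g‖) := by
    rw [h1]; exact (real_inner_le_norm _ _).trans (mul_le_mul_of_nonneg_left (hT g) (norm_nonneg _))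
  by_cases hg0 : g = 0
  · rw [hg0, norm_zero]; positivity
  · have hpos : 0 < ‖g‖ := norm_pos_iff.mpr hg0
    nlinarith [h2, hpos, norm_nonneg f]

/-- **a covariance is non-negative**: `⟨v, Cv⟩ = ⟨c, Sc⟩ ≥ 0`, `c = Cv ∈ K` (`C = ι(ι*Sι)⁻¹ι*` p22's `covOp K S`, `S > 0` on `K`).
[cite: Balaban1984PropagatorsII, (2.131) p.246 («all the necessary properties of the operators H_j, G̃_j»; elementary step, ours)] -/
theorem inner_covOp_nonneg (K : Submodule ℝ E) (S : E →ₗ[ℝ] E) (hpos : ∀ k : ↥K, k ≠ 0 → 0 < ⟪(k : E), S k⟫_ℝ) (v : E) :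
    0 ≤ ⟪v, covOp K S v⟫_ℝ := by
  set c : ↥K := covOpT K S v with hc
  have hcov : covOp K S v = (c : E) := rfl
  rw [hcov, real_inner_comm (c : E) v, ← covOp_sol K S hpos c v, hcov]
  by_cases h0 : c = 0
  · rw [h0, Submodule.coe_zero, inner_zero_left]
  · exact (hpos c h0).le

/-- **`S ≥ γ` on `K` ⇒ `‖Cv‖ ≤ γ⁻¹‖v‖`** for the covariance of a symmetric form positive on `K` (`norm_le_of_form_le` with p22 gen 10's
`inner_covOp_le_of_ge'`). [cite: Balaban1984PropagatorsII, p.248, text after (2.147) («a similar bound from above»; elementary step, ours)] -/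
theorem norm_covOp_le_of_ge (K : Submodule ℝ E) (S : E →ₗ[ℝ] E) (hS : ∀ x y, ⟪S x, y⟫_ℝ = ⟪x, S y⟫_ℝ)
    (hpos : ∀ k : ↥K, k ≠ 0 → 0 < ⟪(k : E), S k⟫_ℝ) {γ : ℝ} (hγ : 0 < γ)
    (hlow : ∀ k : ↥K, γ * ‖(k : E)‖ ^ 2 ≤ ⟪(k : E), S k⟫_ℝ) (v : E) : ‖covOp K S v‖ ≤ γ⁻¹ * ‖v‖ :=
  norm_le_of_form_le (covOp K S) (covOp_symm K S hS hpos) (inner_covOp_nonneg K S hpos) (inv_nonneg.2 hγ.le)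
    (inner_covOp_le_of_ge' K S hpos hγ hlow) v

end Generic

/-! ## §2  `‖H_jB‖ ≤ (d+1)·A·K·n^{(d+1)/2}·‖B‖` -/

section HjEntry

variable {P : Params} {c : ℝ} (hc : c ≠ 0) {j : ℕ} (hj : j + 1 ≤ P.m + P.K) (Λ' : Finset (Site P (j + 1)))
  {w : CIdx j Λ' → ℝ} (hw : ∀ i, 0 < w i)

include hw in
/-- **the matrix of the concrete `H_j`**: `⟨e_{b₀}, H_je_b⟩ = Re HkOp((EK b₀₋, dir b₀), (b₋, dir b))` (gen 9's `Hj_single_apply'`, read at the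
Euclidean basis vectors). [cite: Balaban1984PropagatorsII, (2.130) p.246] -/
theorem Hj_single_eq_re [DecidableEq (PBond P j)] (b : PBond P j) (b₀ : PBond P 0) :
    (tsV1 hc Λ' w).Hj (EuclideanSpace.single b (1 : ℝ)) b₀ =
      (HkOp (P.L ^ j) (Mk P j) (EK (Nat.le_of_succ_le hj) b₀.src, b₀.dir) ((b.src, b.dir) : Tor (Mk P j) × Fin P.d)).re :=
  Hj_single_apply' hc hj Λ' hw b b₀

/-- **fibres over the initial point**: if at most `N` sites of `T^{(k)}` have a given image under `π`, at most `N·d` bonds have their initial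
point there. [cite: Balaban1984PropagatorsI, (1.1) p.18] -/
theorem card_filter_src_le {k : ℕ} {α : Type*} [DecidableEq α] (π : Site P k → α) {N : ℕ}
    (hN : ∀ t, (Finset.univ.filter fun x : Site P k => π x = t).card ≤ N) (t : α) :
    (Finset.univ.filter fun b : PBond P k => π b.src = t).card ≤ N * P.d := by
  have h : (Finset.univ.filter fun b : PBond P k => π b.src = t) =
      ((Finset.univ.filter fun x : Site P k => π x = t) ×ˢ (Finset.univ : Finset (Fin P.d))).map
        (LatticeFieldCalculus.bondEquiv (P := P) (j := k)).toEmbedding := by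
    ext b
    rw [Finset.mem_map_equiv, Finset.mem_product, Finset.mem_filter, Finset.mem_filter]
    exact ⟨fun h => ⟨⟨Finset.mem_univ _, h.2⟩, Finset.mem_univ _⟩, fun h => ⟨Finset.mem_univ _, h.1.2⟩⟩
  rw [h, Finset.card_map, Finset.card_product, Finset.card_univ, Fintype.card_fin]
  exact Nat.mul_le_mul_right _ (hN t)

end HjEntry

section HjNorm

variable {d L m K : ℕ} [NeZero L] {hd : 1 ≤ d + 1} {hL : Odd L ∧ 1 < L} {c : ℝ} (hc : c ≠ 0) {j : ℕ}
  (hj : j + 1 ≤ (⟨d + 1, L, m, K, hd, hL⟩ : Params).m + (⟨d + 1, L, m, K, hd, hL⟩ : Params).K)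
  (Λ' : Finset (Site (⟨d + 1, L, m, K, hd, hL⟩ : Params) (j + 1))) {w : CIdx j Λ' → ℝ} (hw : ∀ i, 0 < w i)

include hj hw in
/-- **«ALL THE NECESSARY PROPERTIES OF THE OPERATORS H_j, G̃_j» (p. 246), THE ℓ²-BOUND OF `H_j`, for the concrete `H_j` of the two-scale V1 data**:
`‖H_jB‖² ≤ ((d+1)·A·K)²·n^{d+1}·‖B‖²`, `A = MG163(d+1)·periodConst(κ₁₆₃(d+1), d)`, `K = latticeConst(d+1)(κ₁₆₃(d+1)/(d+1))`, `n = L^j` — uniformly in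
the volume `(m, K)` and in `Λ′` (b05's entry decay `norm_HkOp_le` + file 1's rectangular Schur test; `n^{d+1}` is the V1 normalisation of the fine `ℓ²`).
[cite: Balaban1984PropagatorsII, p.246, text after (2.131)] -/
theorem norm_Hj_sq_le (B : UBond (⟨d + 1, L, m, K, hd, hL⟩ : Params) j) :
    ‖(tsV1 hc Λ' w).Hj B‖ ^ 2 ≤
      ((d + 1 : ℝ) * (MG163 (d + 1) * periodConst (kappa163 (d + 1)) d * latticeConst (d + 1) (kappa163 (d + 1) / (d + 1)))) ^ 2 *
        ((L : ℝ) ^ j) ^ (d + 1) * ‖B‖ ^ 2 := by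
  classical
  have hj' : j ≤ (⟨d + 1, L, m, K, hd, hL⟩ : Params).m + (⟨d + 1, L, m, K, hd, hL⟩ : Params).K := Nat.le_of_succ_le hj
  have ha : 0 < kappa163 (d + 1) / (d + 1) := div_pos (kappa163_pos _) (by positivity)
  have hA : 0 ≤ MG163 (d + 1) * periodConst (kappa163 (d + 1)) d := mul_nonneg (MG163_nonneg _) (periodConst_pos (kappa163_pos _) _).le
  have hT : ∀ (b₀ : PBond (⟨d + 1, L, m, K, hd, hL⟩ : Params) 0) (b : PBond (⟨d + 1, L, m, K, hd, hL⟩ : Params) j),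
      |(tsV1 hc Λ' w).Hj (EuclideanSpace.single b (1 : ℝ)) b₀| ≤
        (MG163 (d + 1) * periodConst (kappa163 (d + 1)) d) *
          Real.exp (-(kappa163 (d + 1) / (d + 1) * torusSupNorm (Mk ⟨d + 1, L, m, K, hd, hL⟩ j)
            (rep (Mk ⟨d + 1, L, m, K, hd, hL⟩ j) (B5Blocks16.blockOf ((⟨d + 1, L, m, K, hd, hL⟩ : Params).L ^ j)
              (Mk ⟨d + 1, L, m, K, hd, hL⟩ j) (EK hj' b₀.src)) - rep (Mk ⟨d + 1, L, m, K, hd, hL⟩ j) b.src))) := by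
    intro b₀ b
    rw [Hj_single_eq_re hc hj Λ' hw]
    obtain ⟨y', r, h⟩ := exists_eq_bpt ((⟨d + 1, L, m, K, hd, hL⟩ : Params).L ^ j) (Mk ⟨d + 1, L, m, K, hd, hL⟩ j) (EK hj' b₀.src)
    have hb : B5Blocks16.blockOf ((⟨d + 1, L, m, K, hd, hL⟩ : Params).L ^ j) (Mk ⟨d + 1, L, m, K, hd, hL⟩ j) (EK hj' b₀.src) = y' := by
      rw [h, blockOf_bpt]
    rw [hb, h]
    have h2 := norm_HkOp_le ((⟨d + 1, L, m, K, hd, hL⟩ : Params).L ^ j) (Mk ⟨d + 1, L, m, K, hd, hL⟩ j) b₀.dir b.dir r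
      (rep (Mk ⟨d + 1, L, m, K, hd, hL⟩ j) y') (rep (Mk ⟨d + 1, L, m, K, hd, hL⟩ j) b.src)
    rw [toT_rep, toT_rep] at h2
    exact (Complex.abs_re_le_norm _).trans h2
  have h := norm_sq_le_of_entry_decay (Mk ⟨d + 1, L, m, K, hd, hL⟩ j) (tsV1 hc Λ' w).Hj
    (fun b₀ : PBond (⟨d + 1, L, m, K, hd, hL⟩ : Params) 0 =>
      B5Blocks16.blockOf ((⟨d + 1, L, m, K, hd, hL⟩ : Params).L ^ j) (Mk ⟨d + 1, L, m, K, hd, hL⟩ j) (EK hj' b₀.src))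
    (fun b : PBond (⟨d + 1, L, m, K, hd, hL⟩ : Params) j => b.src)
    (card_filter_src_le _ (card_filter_blockOf_EK_le hj'))
    (card_filter_src_le (fun y => y) (card_filter_eq_le_one (P := (⟨d + 1, L, m, K, hd, hL⟩ : Params)) (j := j))) hA ha hT B
  refine h.trans (le_of_eq ?_)
  push_cast
  ring

include hj hw in
/-- … hence **`‖H_jB‖ ≤ (d+1)·A·K·√(n^{d+1})·‖B‖`**. [cite: Balaban1984PropagatorsII, p.246, text after (2.131)] -/
theorem norm_Hj_le (B : UBond (⟨d + 1, L, m, K, hd, hL⟩ : Params) j) :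
    ‖(tsV1 hc Λ' w).Hj B‖ ≤
      (d + 1 : ℝ) * (MG163 (d + 1) * periodConst (kappa163 (d + 1)) d * latticeConst (d + 1) (kappa163 (d + 1) / (d + 1))) *
        Real.sqrt (((L : ℝ) ^ j) ^ (d + 1)) * ‖B‖ := by
  have h := norm_Hj_sq_le hc hj Λ' hw B
  have ha : 0 < kappa163 (d + 1) / (d + 1) := div_pos (kappa163_pos _) (by positivity)
  have hA : 0 ≤ MG163 (d + 1) * periodConst (kappa163 (d + 1)) d := mul_nonneg (MG163_nonneg _) (periodConst_pos (kappa163_pos _) _).le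
  have hK : 0 ≤ latticeConst (d + 1) (kappa163 (d + 1) / (d + 1)) := latticeConst_nonneg _ ha.le
  have hn : 0 ≤ ((L : ℝ) ^ j) ^ (d + 1) := by positivity
  have h0 : 0 ≤ (d + 1 : ℝ) * (MG163 (d + 1) * periodConst (kappa163 (d + 1)) d * latticeConst (d + 1) (kappa163 (d + 1) / (d + 1))) *
      Real.sqrt (((L : ℝ) ^ j) ^ (d + 1)) * ‖B‖ := by positivity
  have hs : Real.sqrt (((L : ℝ) ^ j) ^ (d + 1)) ^ 2 = ((L : ℝ) ^ j) ^ (d + 1) := Real.sq_sqrt hn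
  refine le_of_sq_le_sq ?_ h0
  calc ‖(tsV1 hc Λ' w).Hj B‖ ^ 2 ≤ _ := h
    _ = ((d + 1 : ℝ) * (MG163 (d + 1) * periodConst (kappa163 (d + 1)) d * latticeConst (d + 1) (kappa163 (d + 1) / (d + 1)))) ^ 2 *
        Real.sqrt (((L : ℝ) ^ j) ^ (d + 1)) ^ 2 * ‖B‖ ^ 2 := by rw [hs]
    _ = ((d + 1 : ℝ) * (MG163 (d + 1) * periodConst (kappa163 (d + 1)) d * latticeConst (d + 1) (kappa163 (d + 1) / (d + 1))) *
        Real.sqrt (((L : ℝ) ^ j) ^ (d + 1)) * ‖B‖) ^ 2 := by ring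

end HjNorm

/-! ## §3  `γ₀‖A‖² ≤ ⟨A, M_jA⟩` on `{Q_jA = 0}`; `⟨x, G̃_jx⟩ ≤ γ₀⁻¹‖x‖²`, `‖G̃_jx‖ ≤ γ₀⁻¹‖x‖` (scaling `c = η⁻¹ = L^j`) -/

section MjGt

variable {P : Params} {j : ℕ} (hc : ((P.L : ℝ) ^ j) ≠ 0) (hj : j + 1 ≤ P.m + P.K) (Λ' : Finset (Site P (j + 1)))
  {w : CIdx j Λ' → ℝ} (hw : ∀ i, 0 < w i)

/-- `N(Q′) = N(Q′_j)` for the whole-torus family of order `j` (r03's `mem_ker_QpE_whole_iff`, pointwise form = the hypothesis `hD` of r03's bridge).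
[cite: Balaban1984PropagatorsII, (2.10) p.225] -/
theorem qpE_whole_eq_zero_iff (hj' : j ≤ P.m + P.K) (μ : ScalarSpace P) :
    QpE (Domains.whole (P := P) j hj') μ = 0 ↔ siteAvgIter j (WithLp.ofLp μ) = 0 := by
  rw [← LinearMap.mem_ker]; exact mem_ker_QpE_whole_iff hj' μ

/-- **the weight dictionary at the whole torus** (the hypothesis `hQ` of r03's bridge): with the constant weight `a·n^d` (`d = P.d`, `n = L^j`) on
`𝔅 = bonds of T^{(j)}`, `⟨QA′, aQA⟩ = a·n^d·Σ_b (Q_jA′)(b)(Q_jA)(b)`. [cite: Balaban1984PropagatorsI, (1.69) p.29, (1.21) p.21] -/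
theorem inner_QE_aE_whole (hj' : j ≤ P.m + P.K) (a : ℝ) (x' x : BondSpace P) :
    ⟪QE (Domains.whole (P := P) j hj') x',
        aE (Domains.whole (P := P) j hj') (fun _ => a * ((P.L : ℝ) ^ j) ^ P.d) (QE (Domains.whole (P := P) j hj') x)⟫_ℝ =
      a * ((P.L : ℝ) ^ j) ^ P.d * ∑ b : PBond P j, bondAvgIter j (WithLp.ofLp x') b * bondAvgIter j (WithLp.ofLp x) b := by
  rw [inner_eq_sum, ← (idxB_bijective hj').sum_comp, Finset.mul_sum]
  refine Finset.sum_congr rfl fun b _ => ?_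
  have e1 : QE (Domains.whole (P := P) j hj') x' (idxB hj' b) = bondAvgIter j (WithLp.ofLp x') b := rfl
  have e2 : QE (Domains.whole (P := P) j hj') x (idxB hj' b) = bondAvgIter j (WithLp.ofLp x) b := rfl
  rw [aE_apply, e1, e2]
  ring

include hj hw in
/-- **[4] (1.72)/(1.90) FOR `M_j = Δ − ∂P_j∂*` OF THE TWO-SCALE V1 DATA ON `{Q_jA = 0}`** (p. 246 *"They follow from the Proposition 1.2"* [of [4]]):
`γ₀(d,1)·‖A‖² ≤ ⟨A, M_jA⟩` whenever `Q_jA = 0`, `γ₀ = …B5Prop11Lattice.gammaZero P.d 1` (dimension-only) — at the paper's scaling `c = η⁻¹ = L^j`,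
uniformly in the volume and in `Λ′` (on `{Q_jA = 0}`, `⟨A, M_jA⟩` = the whole-torus `⟨A, Δ_aA⟩` with [4]'s `a = 1`; r03's `form_deltaAE` + r02's
`ineq190_form` + `Σ_ν∇_ν*∇_ν ≥ 0`). [cite: Balaban1984PropagatorsII, p.246, text after (2.131)] -/
theorem inner_Mj_ge_of_Qv_eq_zero (v : BondSpace P) (hv : (tsV1 hc Λ' w).Qv v = 0) :
    gammaZero P.d 1 * ‖v‖ ^ 2 ≤ ⟪v, (tsV1 hc Λ' w).Mj v⟫_ℝ := by
  have hL := isLattice Λ' hc hj hw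
  have hj' : j ≤ P.m + P.K := Nat.le_of_succ_le hj
  -- (a) on `{Q_jA = 0}` the form of `M_j` is the whole-torus `⟨A, Δ_aA⟩` (any weight; here `n^d`)
  have hQE : ∀ i, QE (Domains.whole (P := P) j hj') v i = 0 := by
    intro i
    obtain ⟨b, rfl⟩ := (idxB_bijective hj').2 i
    have e : QE (Domains.whole (P := P) j hj') v (idxB hj' b) = (tsV1 hc Λ' w).Qv v b := rfl
    rw [e, hv]
    rfl
  have h1 : ⟪v, (tsV1 hc Λ' w).Mj v⟫_ℝ =
      ⟪v, deltaAE (Domains.whole (P := P) j hj') ((P.L : ℝ) ^ j) (fun _ => (1 : ℝ) * ((P.L : ℝ) ^ j) ^ P.d) v⟫_ℝ := by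
    have hz : ∑ i, (fun _ : BondIdx (Domains.whole (P := P) j hj') => (1 : ℝ) * ((P.L : ℝ) ^ j) ^ P.d) i *
        QE (Domains.whole (P := P) j hj') v i ^ 2 = 0 :=
      Finset.sum_eq_zero fun i _ => by rw [hQE i]; ring
    rw [form_Mj hL, inner_deltaAE_self, hz, add_zero, Rj_eq_RE hc Λ' hj']
    rfl
  -- (b) r03's bridge: the V1 form is r02's matrix form `Ã†Δ_a^{[4]}Ã` with `a = 1`
  have h2 := form_deltaAE hj' (Domains.whole (P := P) j hj') (qpE_whole_eq_zero_iff hj') one_pos (inner_QE_aE_whole hj' 1) v v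
  -- (c) r02's (1.90) `Δ_a ≥ γ₀(Δ + I)` and `Δ = Σ_ν∇_ν*∇_ν ≥ 0`, `Ã†Ã = ‖A‖²`
  have hn : 1 ≤ P.L ^ j := Nat.one_le_pow _ _ P.L_pos
  have h3 := ineq190_form (P.L ^ j) hn (Mk P j) 1 one_pos (TV hj' v)
  have h4 : ‖v‖ ^ 2 ≤ (star (TV hj' v) ⬝ᵥ ((Lap (P.L ^ j) (Mk P j) + 1) *ᵥ TV hj' v)).re := by
    have h0 : 0 ≤ (star (TV hj' v) ⬝ᵥ (Lap (P.L ^ j) (Mk P j) *ᵥ TV hj' v)).re := by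
      rw [Lap, Matrix.sum_mulVec, dotProduct_sum, Complex.re_sum]
      exact Finset.sum_nonneg fun ν _ => by rw [form_gram, Complex.ofReal_re]; exact nsq_nonneg _
    rw [Matrix.add_mulVec, Matrix.one_mulVec, dotProduct_add, Complex.add_re, star_TV_dotProduct_TV, Complex.ofReal_re,
      real_inner_self_eq_norm_sq]
    linarith
  have h5 : (star (TV hj' v) ⬝ᵥ (DeltaA (P.L ^ j) (Mk P j) 1 *ᵥ TV hj' v)).re = ⟪v, (tsV1 hc Λ' w).Mj v⟫_ℝ := by
    rw [h2, Complex.ofReal_re, ← h1]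
  calc gammaZero P.d 1 * ‖v‖ ^ 2
      ≤ gammaZero P.d 1 * (star (TV hj' v) ⬝ᵥ ((Lap (P.L ^ j) (Mk P j) + 1) *ᵥ TV hj' v)).re :=
        mul_le_mul_of_nonneg_left h4 (gammaZero_pos _ _).le
    _ ≤ _ := h3.trans_eq h5

include hj hw in
/-- `M_j > 0` on `{Q_jA = 0} ∖ 0` in the shape of the covariance lemmas. [cite: Balaban1984PropagatorsII, (2.114) p.243] -/
theorem Mj_pos_NA (k : ↥(tsV1 hc Λ' w).NA) (hk : k ≠ 0) : 0 < ⟪(k : BondSpace P), (tsV1 hc Λ' w).Mj k⟫_ℝ :=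
  Mj_pos_ker (isLattice Λ' hc hj hw) (positive Λ' hc hj w) (k : BondSpace P) (LinearMap.mem_ker.mp k.2)
    (fun h => hk (Subtype.ext h))

include hj hw in
/-- **p. 246 «all the necessary properties of the operators H_j, G̃_j … follow from the Proposition 1.2» — THE ℓ²-UPPER BOUND of the concrete `G̃_j`
(2.131) of the two-scale V1 data, as a form**: `⟨x, G̃_jx⟩ ≤ γ₀(d,1)⁻¹‖x‖²`
for every `x`, at `c = L^j`, uniformly in the volume and in `Λ′` (`G̃_j` = the covariance of `M_j` on `{Q_jA = 0}`; gen 10's `inner_covOp_le_of_ge'`).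
[cite: Balaban1984PropagatorsII, p.246, text after (2.131)] -/
theorem inner_Gt_le (x : BondSpace P) : ⟪x, (tsV1 hc Λ' w).Gt x⟫_ℝ ≤ (gammaZero P.d 1)⁻¹ * ‖x‖ ^ 2 :=
  inner_covOp_le_of_ge' (tsV1 hc Λ' w).NA (tsV1 hc Λ' w).Mj (Mj_pos_NA hc hj Λ' hw) (gammaZero_pos _ _)
    (fun k => inner_Mj_ge_of_Qv_eq_zero hc hj Λ' hw (k : BondSpace P) (LinearMap.mem_ker.mp k.2)) x

include hj hw in
/-- `⟨x, G̃_jx⟩ ≥ 0`. [cite: Balaban1984PropagatorsII, (2.131) p.246] -/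
theorem inner_Gt_nonneg (x : BondSpace P) : 0 ≤ ⟪x, (tsV1 hc Λ' w).Gt x⟫_ℝ :=
  inner_covOp_nonneg (tsV1 hc Λ' w).NA (tsV1 hc Λ' w).Mj (Mj_pos_NA hc hj Λ' hw) x

include hj hw in
/-- **… and as an operator bound**: `‖G̃_jx‖ ≤ γ₀(d,1)⁻¹‖x‖`. [cite: Balaban1984PropagatorsII, p.246, text after (2.131)] -/
theorem norm_Gt_le (x : BondSpace P) : ‖(tsV1 hc Λ' w).Gt x‖ ≤ (gammaZero P.d 1)⁻¹ * ‖x‖ :=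
  norm_covOp_le_of_ge (tsV1 hc Λ' w).NA (tsV1 hc Λ' w).Mj (Mj_symm (isLattice Λ' hc hj hw)) (Mj_pos_NA hc hj Λ' hw)
    (gammaZero_pos _ _) (fun k => inner_Mj_ge_of_Qv_eq_zero hc hj Λ' hw (k : BondSpace P) (LinearMap.mem_ker.mp k.2)) x

end MjGt

end Literature.MathematicalPhysics.QuantumFieldTheory.Balaban1983to89.B6HjGtOpNormV1

end
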